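import Mathlib
import HarnessLib
import HarnessLib.Audit
import Summits.RiemannHypothesis.Statement
import HarnessLib.Audit.Status.Attr

/-!
Route: SignCone

CLOSED (superseded) 2026-08-17T13:36:03Z by planner-rbadge-RiemannHypothesis-SignCone-9cfede98-g2-0 — reason: superseded:route-RiemannHypothesis-WeilPos — superseded by route-RiemannHypothesis-WeilPos — note: route-repair badge gen 2 (unit rbadge-RiemannHypothesis-SignCone-9cfede98-g2), 2026-08-17T13:40Z — CLOSE: criterion delivered and banked; the one remaining leaf IS the summit. (1) DELIVERED: the deciding theorem `closes : SignConeInequality → ConeMagnification → SignConeDuality → RH` has both non-X . The file is kept as the record of this route; refuted decls are indexed as negative knowledge (`ledger negatives`).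

# Route SignCone — Weil positivity dualised in the prime weights — the prime-free sign-cone
inequality with unit slack (2001 fefr/swcm resurrected)

It suffices to show X = the SIGN-CONE INEQUALITY WITH UNIT SLACK: for every cutoff a > 0 and every
test F in the Weil cone P(a)
(finite sums F = Σ_i g_i ⋆ g̃_i of autocorrelations of smooth g_i supported in [−a, a]; tree notions
`IsWeilTest`, `weilConv`, `weilReflect`, spelled out
over Mathlib primitives in the items since rev 3 — definitionally equal, see CONE NOTE under
DEFINITION REQUESTS) that is NON-NEGATIVE AT EVERY INTEGER
NODE, Re F(log n) ≥ 0 for all n ≥ 2, the ARCHIMEDEAN-PLUS-POLAR part of Weil's functional alone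
satisfies Re W_ar(F) ≥ −Re F(0),
W_ar := `weilPolarTerm` + `weilArchTerm` (no von Mangoldt weight, no zero of ζ anywhere in X).
STATUS (rev 7, route-repair badge, 2026-08-17T12:40Z): CONDITIONAL BRIDGE ON X — AND THE BRIDGE IS
BUILT. The direction X ⇒ RH, which the 2001
programme proved but never published, is now KERNEL-CHECKED END TO END: conic DUALITY at each cutoff
(X_a ⇒ some nonnegative integer-supported
"fake von Mangoldt" weight c_a, c_a(1) = 0, whose fake Weil form W_ar − P_{c_a} has unit slack at
cutoff a) is the CLOSED item SignConeDuality, and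
MAGNIFICATION on the slack cones (W-MAG 2001: such weights at every cutoff force RH) is the item
ConeMagnification, CLOSED 2026-08-17T12:30Z
(`Cruxes.ConeMagnification.Sketch.ConeMagnification_of`; its zero-free analytic core SlackDesign =
W-MAG Thm 3.1 CLOSED 12:28Z,
`Cruxes.SlackDesign.RealCombType.SlackDesign_of`; chain: slack-cone compactness → fake PNT →
Chebyshev/Mertens → continuation → Carathéodory →
comb/type inequalities → design data → deficit spine → Landau transfer). Hence `closes :
SignConeInequality → ConeMagnification → SignConeDuality →
RH` has exactly ONE open hypothesis, X itself, and with the landed converse RH ⇒ X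
(`signConeInequality_of_riemannHypothesis`, envelope p128354)
the tree now contains a NEW RH-EQUIVALENCE: RH ⇔ the prime-free, zero-free sign-cone inequality with
unit slack (to be banked by name as
`SignConeInequality ↔ RiemannHypothesis`, a three-line Theorems file over the closing theorems —
provable now).
WHY CONDITIONAL: X is RH in sign-cone clothes and the tree says so — X ↔ SignConeOscillatory ↔
OscCoherentCore are LANDED iffs (p129083;
`oscCoherentCore_iff_signConeInequality`, Theorems/SignConeSignConeOscillatoryCoherentCoreCollapse:
every presence-type class split of the sign cone
collapses by appending vanishing two-bumps beyond the support); every line registered on the X side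
ends in ONE RH-equivalent terminal stub
(stub_fakeZeroMeasure ≡ X; stub_extremalNonneg ≡ X, p157126; stub_offLineMoment ⇒ RH, p158819 = the
`skeleton.hides-summit` event of 11:56Z this
revision answers); the crux strategist's census (Cruxes/SignConeOscillatory/STRATEGY-CENSUS.md §1–4)
finds no decomposition, transfer, strengthening or
negation with teeth short of effective magnification. So X is the NAMED HYPOTHESIS of the bridge
(target item SignConeInequality, conditional_on) and keys
no staffing; its in-tree equivalents SignConeOscillatory and OscCoherentCore are banked supports
(never staffed; kept as decls because landed Theorems
name them). What remains staffable are UNCONDITIONAL supports that calibrate X: the certified rungs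
(a ≤ 4/5, 1, 13/10 landed; SignConeUpTo210 next),
the incoherent single-high-window class OscSingleWindow (the one unconditional test of the
uncertainty × node-lattice lever), and the exact chain
ExactConeRigidity (2001 rigidity K = {Λ}: W-COMP + W-SRPP, a second criterion in progress).
Resurrects archive 2001 `summits/rh/routes/fake-explicit-formula-rigidity` (STATUS proving; (R) K ⊆
{Λ}, (S) to x = 210) and
`summits/rh/routes/slack-weil-cone-magnification` (STATUS proving; unit-slack cone, (S♭) ⇔ RH) with
the narrowed summits
`rh-w-prime-free-inequality`, `rh-w-magnification`, `rh-w-effmag`, `rh-w-composite-vanishing`,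
`rh-w-signed-rigidity`.
Lean: `∀ a : ℝ, 0 < a → ∀ (k : ℕ) (g : Fin k → ℝ → ℂ), (∀ i, (ContDiff ℝ ((⊤ : ℕ∞) : WithTop ℕ∞) (g
i) ∧ HasCompactSupport (g i)) ∧ tsupport (g i) ⊆ Set.Icc (-a) a) → let F : ℝ → ℂ := fun t => ∑ i,
MeasureTheory.convolution (g i) (fun u => (starRingEnd ℂ) ((g i) (-u))) (ContinuousLinearMap.mul ℂ
ℂ) MeasureTheory.MeasureSpace.volume t; (∀ n : ℕ, 2 ≤ n → 0 ≤ (F (Real.log n)).re) → let M : ℂ → ℂ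
:= fun s => ∫ u : ℝ, F u * Complex.exp ((s - 1 / 2) * u); -(F 0).re ≤ (M 0 + M 1 + ((1 / (2 *
Real.pi) : ℂ) * (∫ t : ℝ, M (1 / 2 + t * Complex.I) * ((Complex.digamma (1 / 4 + t / 2 *
Complex.I)).re : ℂ)) - F 0 * (Real.log Real.pi : ℂ))).re`

## Assembly
Pure logic (sorry-free, planner glue.lean, rev 7): `closes : SignConeInequality → ConeMagnification
→ SignConeDuality → Summit.RiemannHypothesis`,
proof term `hC (fun a ha => h₃ a ha (hX a ha))`: ConeMagnification (CLOSED) needs a unit-slack fake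
weight at every cutoff; conic duality h₃ (CLOSED)
produces it at each cutoff from the bridge hypothesis hX. Both non-X binders are CLOSED items, so
the deciding theorem is the criterion X ⇒ RH with
no open premise but X. The rev 4–6 seven-binder form (three oscillatory regimes + far field +
SlackDesign + MagnificationOfSlackDesign) is retired:
the regimes collapse in-tree (OscCoherentCore alone implies OscSingleWindow, OscUpToThirteenTenths,
SignConeFarField and X) and SlackDesign →
ConeMagnification is closed on both ends; it is recovered from the bridge form by the case analysis
kept in Theorems/SignConeAssembly.lean. The item
`Assembly` (CLOSED, `signConeAssembly_proof`) keeps the rev-2 four-binder statement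
SignConeOscillatory → ConeMagnification → SignConeDuality →
SignConeFarField → RH, equally true.

Rationale: WHY THIS LINE. Weil's criterion is linear in the PRIME WEIGHTS: W = W_ar − P_Λ with P_c(F) = Σ_n
c(n) n^{−1/2}(F(log n) + F(−log n)), and on the sign
cone (node-nonnegative F) P_c(F) ≥ 0 for EVERY c ≥ 0, so by finite-dimensional conic duality at
cutoff a (archive fefr Thm 7.2; Shapiro-type LP
duality; CLOSED here as SignConeDuality) the prime-free extremal inequality X_a is EQUIVALENT to
feasibility of the unit-slack cone
K♭_a = {c ≥ 0 : W_ar − P_c ≥ −‖g‖² on P(a)}; the 2001 rigidity and magnification theorems (W-COMP +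
W-SRPP: W_c ≥ 0 at all cutoffs forces c = Λ;
W-MAG: any c with bounded defect forces RH; W-EFFMAG: an off-line zero empties K♭_a beyond an
explicit tower) make "feasible at every cutoff"
equivalent to RH (Bombieri2000Weil Thm 1–2 for the Λ-cone; Yoshida1992HermitianForms). The
arithmetic of RH is thereby moved entirely into the NODE
SET {log n : n ≥ 2} and POSITIVE-DEFINITENESS, a dual none of the Λ-keeping routes (WeilPos,
WeilComb, WeilAdversary, WeilGroundState, WeilWindowFlow,
WeilParity, SpectralTrace) has, importing LP/conic duality and Fourier optimization for
sign-constrained positive-definite functions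
(CarneiroMilinovichSoundararajan2019, ChirreGoncalvesLaat2018, arXiv:2003.10771,
BondarenkoRadchenkoSeip2020). REV 7 (route-repair badge,
2026-08-17T12:40Z): the shape is settled by the tree. The magnification direction X ⇒ RH is LANDED
END TO END (SignConeDuality closed;
SlackDesign = W-MAG Thm 3.1 closed 12:28Z; ConeMagnification = W-MAG closed 12:30Z), while the X
side is RH in sign-cone clothes (landed iffs
X ↔ SignConeOscillatory ↔ OscCoherentCore, RH ⇒ X; every registered line ends in an RH-equivalent
stub; strategist census: no split short of
W-EFFMAG). The route is therefore declared a CONDITIONAL BRIDGE on X: its deliverable, the new RH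
criterion X ⇒ RH, is in the tree; a proof of X is
not planned here (it would be a proof of RH with no lever in hand).

RANKED CRUXES. #0 SignConeInequality (target = the NAMED BRIDGE HYPOTHESIS, conditional_on; keys no
staffing) — X: for all a > 0 and all
node-nonnegative F ∈ P(a), Re W_ar(F) ≥ −Re F(0). (why it might fail: RH-equivalent IN-TREE (RH ⇒ X
landed; X ⇒ RH = closes over two closed items);
every registered line ends in an RH-equivalent stub (p157126, p158819); no decomposition short of
effective magnification.) [Bombieri2000Weil,
Yoshida1992HermitianForms, archive:2001/summits/rh/routes/slack-weil-cone-magnification,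
archive:2001/summits/rh/routes/fake-explicit-formula-rigidity,
Cruxes/SignConeOscillatory/STRATEGY-CENSUS.md]
NO OPEN CRUX REMAINS (crux floor waived: conditional bridge). Closed cruxes, for the record:
#3 ConeMagnification (crux, CLOSED 2026-08-17T12:30Z by
`Cruxes.ConeMagnification.Sketch.ConeMagnification_of`; binder hC of closes) — MAGNIFICATION ON
THE SLACK CONES: nonnegative integer-supported unit-slack fake von Mangoldt weights at every cutoff
⇒ RH = the unpublished 2001 W-MAG, now
kernel-checked (compactness p129201, fake PNT p130740, Chebyshev p131015, continuation p130893,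
Laplace positivity p132066, Carathéodory p133591, comb /
type inequalities and design data = SlackDesign, deficit spine p137772, Landau transfer p130783).
[Bombieri2000Weil, archive:2001/summits/rh-w-magnification/free/y1]
#4 SlackDesign (crux, CLOSED 12:28Z by `Cruxes.SlackDesign.RealCombType.SlackDesign_of`) — unit
slack ⇒ design data (AX-A, AX-B, AX-C with constant 1/2),
W-MAG Thm 3.1 at M = 1, zero-free; line real_comb_type: comb inequality (the only place unit slack
enters) + c-free comb asymptotics (combNormAsymp
p158627, combDiffAsymp ⇐ pairData p158652 ⇐ sharpNodeData p159195 ⇐ combTypeSharpNodeData) ⇒ finite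
log-Riesz type inequalities ⇒ design data.
[archive:2001/summits/rh-w-magnification/free/y1 (Thm 3.1),
archive:2001/summits/rh-w-composite-vanishing/free/y1]
#4 SignConeDuality (crux, CLOSED: `SignConeDuality_of` @ b13840cce207; binder h₃) — conic duality at
each cutoff: X_a ⇒ K♭_a ≠ ∅ (Slater point, dual
attainment). #9 SignConeFarField (CLOSED, far-field class, margin −0.763),
MagnificationOfSlackDesign (CLOSED), OscUpToThirteenTenths (CLOSED: X
unconditionally for a ≤ 13/10, certificate pwCert13s), Assembly (CLOSED, rev-2 statement).
OPEN SUPPORTS (staffable by idle provers; none load-bearing for closes; each an honest unconditional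
theorem): SignConeUpTo210 (the next certified rung
a ≤ (log 210)/2 by the landed pwCert pipeline; rungs 3/2 and 2 first), ExactConeRigidity (the exact,
slack-free chain: rigidity K = {Λ} by W-COMP +
W-SRPP, then `weil_criterion_holds` — a SECOND 2001 criterion in progress,
Theorems/SignConeExactConeRigidity*), OscSingleWindow (re-badged crux →
support: X on the incoherent single-high-window class T ≥ 3 — where the lattice-chirp /
completion-cost lever is claimed to bite; RH-implied, non-empty
for a > 3/2 (p150937), implied by X in-tree, the one UNCONDITIONAL test of the route's own
mechanism, either outcome informative; skeleton d4a9010c3867).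
BANKED SUPPORTS (rev 7; ≡ X, never to be staffed; re-asked after the drop of 12:29Z only so that the
landed Theorems naming the decls keep compiling):
SignConeOscillatory (≡ X, p129083; prover verdicts open-problem ×3; lines Sketch / dual_witness end
in stubs ≡ X) and OscCoherentCore (≡ X by the landed
collapse; line Sketch = off-line defect ledger, terminal stub_offLineMoment ⇒ RH, p158819 — the
skeleton.hides-summit event this revision answers; its
unconditional stubs A/B/D landed p158736 p158785 p159053 and stub_cutoffKernelBound, stub_transfer,
OscCoherentCore-of-offLineMoment landed 12:11–12:28Z:
the per-cutoff transfer `window law at cutoff a ⇒ X at cutoff a` is a finished quantitative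
theorem).
WANTED FROM ANY IDLE PROVER (no item needed, --supports stmt-RiemannHypothesis-16301): the banked
criterion `theorem signConeInequality_iff_riemannHypothesis :
SignConeInequality ↔ RiemannHypothesis := ⟨fun h => closes h (ConeMagnification-closing theorem)
(SignConeDuality-closing theorem), signConeInequality_of_riemannHypothesis⟩`
(today it exists only with h₂ h₃ as hypotheses, in Theorems/SignConeSignConeOscillatoryStatus.lean,
which moreover applies the stale rev-3 closes).

TWO-LAYER PLAN. Nothing left to split: the only glued split, ConeMagnification ⇐ SlackDesign ∧
MagnificationOfSlackDesign, is CLOSED on every node; the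
rev 4–6 oscillatory split SignConeOscillatory ⇐ OscUpToThirteenTenths ∧ OscSingleWindow ∧
OscCoherentCore is RETIRED (kernel-checked collapse:
OscCoherentCore alone implies the other two and X; disprover cycle 1: "presence-type class splits
collapse; a split that bites must quantify the DEPTH of
low negativity relative to F(0) or pin the cutoff to the support").

KILL CRITERIA. (i) A certified node-nonnegative F ∈ P(a) with Re W_ar(F) < −Re F(0) at ANY cutoff
refutes X — and now, through the landed
criterion, RH itself (`not_riemannHypothesis_of_not_crux`): the bridge hypothesis dies together with
the summit; the witness is a Σ₁ certificate worth
more than the route. (ii) Nothing load-bearing is left to refute: ConeMagnification, SlackDesign,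
SignConeDuality are closed. (iii) If route WeilPos (or
any route) proves Weil positivity ∀a, X follows in two lines and the bridge FIRES: RH in-tree
through this closes. (iv) The route cannot itself close RH:
its deliverable (the criterion) is in; tenure / the human may `route close --as superseded` once the
criterion theorem is banked by name and the open
supports (SignConeUpTo210, ExactConeRigidity, OscSingleWindow) are re-homed or finished — recorded
here so no seat mistakes sibling-stub progress on X
for distance reduction.

NOT DECOMPOSED YET. X is DELIBERATELY not decomposed (strategist census §1: class / cutoff /
conclusion / bridge / zero-side splits all reduce to X
relabelled or need W-EFFMAG as assembly; best typed candidate D5 = VariationalAttainment ∧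
TightCertificatesNonneg kernel-checked and rejected in
spirit). Inside OscSingleWindow: the Poisson/aliasing identity, chirp-kernel
modulus and completion-cost inequality (SketchIdeator1.lean) stay prover stubs. The next unit-slack
rungs (3/2, 2, (log 210)/2 = SignConeUpTo210) are
supports filed as they are attempted. Hypothesis P of the 2001 programme (character-twisted
resonator designs; an unconditional o(√x/a) lower bound
for μ(a)) remains prover-level.

CHEAPEST FALSIFIER. For the bridge hypothesis X: the standing kit LPs (minimise Re W_ar(F)/Re F(0)
over B-spline families in P(a) under the node
constraints; DUAL-NUMERICS j023039, j020376/j020695): any certified value < −1 at any cutoff kills X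
and RH; observed minima +0.048, +0.033, +0.025,
+0.021 at a = 1, 1.5, 2, 2.3 (node-vanishing, low-frequency optimisers; LP duals = Λ(n) to 1–5 % on
prime powers). (SlackDesign is closed; its SlackBall tightness family
p130627 and the planted-zero calibration j021410 — finite cutoffs are blind — stay on record.)
Lookup falsifier for novelty: Yoshida 1992 §§2–4, Bombieri 2000 §§10–12, Bombieri 2003 (variational
approach,
doi:10.1002/cpa.10089) treat the Λ-form and its minimisers, not the dual in the weights.

NUMBERS. Crude far-field coefficient −0.763 (w-root t_w = 0.28126, ∫₀^{log2}(2w+1/sinh) = 2.4596,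
log 4π + γ = 3.1082, ∫_{t_w}^{log 2} w = 0.3032,
∫_{log2}^∞ dt/sinh t = log 3); certified rungs a ≤ 4/5 (c = 0), 1 (fake primes on {2,3,4,5,7},
pwCert1), 13/10 (fake weights on n = 3..12, pwCert13s);
2001: (S) certified for x ≤ 210; ε(a) > 0 certified only for x ≤ 26 (10⁻¹²⁹ at x = 26); NF rows W_ar
≥ 0.028 F(0) on CONE(1/20); pinning
|c(2) − log 2| ≤ 10⁻²⁵, |c(3) − log 3| ≤ 1.4·10⁻²³ for c ∈ K; W-MAG deficit bound Σ_p (log p −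
c(p))₊/√p ≤ 2M on K^{(M)}; trivial bound
μ(a) ≥ −(8 sinh a + 6); W-EFFMAG tower A(M,β₀,γ₀) = 2exp(1.1e^{L₁}L₁⁻⁸)+3, L₁ = (M+2)exp(4e^{2a₂*});
off-line defect ledger constant
κ(a) = 1/(400(2a+1)³cosh(a+½)(a+1)).

DEFINITION REQUESTS. None required. CONE NOTE (rev 3, kept): every item is stated over MATHLIB
PRIMITIVES ONLY — IsWeilTest g ↦ ContDiff ℝ ⊤ g ∧
HasCompactSupport g; weilConv g (weilReflect g) ↦ MeasureTheory.convolution g (fun u => conj (g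
(-u))) (ContinuousLinearMap.mul ℂ ℂ) volume; weilMellin F ↦
the binder M := fun s => ∫ u, F u * Complex.exp ((s - 1/2) * u); weilPolarTerm F + weilArchTerm F ↦
M 0 + M 1 + ((1/(2π)) * ∫ t, M (1/2 + t·I) *
Re ψ(1/4 + t·I/2) − F 0 * log π) — each DEFINITIONALLY EQUAL (`Iff.rfl`, evidence Sketch.lean of rev
3) to its rev-2 form over
Literature.NumberTheory.LFunctions.WeilExplicit, so provers `show`/`change` to the Literature
vocabulary and use its API (explicit_formula_holds,
weil_criterion_holds, weilArchTermBombieri_eq_weilArchTerm_holds). WHY: WeilExplicit.lean co-hosts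
the @[conjecture] decl WeilPositivity (↔ RH), which the
Phase-C guardrail would count as an unproved fact of the MODULE cone; with no Literature import the
module cone is Mathlib + HarnessLib +
Summits.RiemannHypothesis.Statement, conjecture-free (needs-fact: NONE; route imports []). CAVEAT
(tenure): a `_holds` link whose Theorems module imports
WeilExplicit would re-import the conjecture's module; the standing operator request is `ledger
promote request Literature.NumberTheory.LFunctions.WeilPositivity`
(own leaf module). TREE-HEALTH (refuter note 09:12Z, repeated): Theorems/SignConeAssembly.lean
(`example : Assembly := closes`) and
Theorems/SignConeSignConeOscillatoryStatus.lean (`closes h₁ h₂ h₃ h₄`) still apply the rev-3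
four-binder closes and break on rebuild since rev 5; the
prover-side fix is `signConeAssembly_proof h₁ h₂ h₃ h₄` in place of `closes …` (maintenance patch,
no item).

Novelty: Searches (2026-08-16, opening seat): `lit search "Fourier optimization prime gaps" --source arxiv`
(3: CarneiroMilinovichSoundararajan2019,
arXiv:2411.05095, arXiv:2012.07781); `lit search "Fourier interpolation zeros zeta" --source arxiv`
(2: BondarenkoRadchenkoSeip2020, arXiv:2509.17600);
`lit search "sign uncertainty principle Bourgain Clozel Kahane" --source arxiv` (6 incl.
arXiv:2003.10771, arXiv:2210.01684); `lit search "Chirre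
Goncalves de Laat pair correlation semidefinite"` (ChirreGoncalvesLaat2018); `lit search "Weil
criterion positivity explicit formula fake von Mangoldt
rigidity" --source zbmath` (0); `lit search "Yoshida Hermitian forms attached to zeta functions"
--source zbmath` (zbl:0817.11041); `lit galaxy search
"Weil's criterion" --star all` (relevant: Bombieri 2000, pdf:4005501466549090220). Searches
(2026-08-17, rev 7): `lit search "Weil explicit formula
positivity criterion" --source zbmath` (9: zbl:1119.11051 Lagarias survey,
doi:10.1006/jnth.1999.2392 Bombieri–Lagarias on Li's criterion,
doi:10.1002/cpa.10089 Bombieri 2003 variational, doi:10.1017/9781108178266 Broughan 2017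
"Equivalents of RH vol. 2", arXiv:math/9809119 Burnol,
doi:10.1142/s1793042112500327 Li 2012); `lit search "Hermitian forms attached to zeta functions"
--source zbmath` (Yoshida 1992 zbl:0817.11041);
`lit galaxy search "Weil's explicit formula positivity" / "Weil's criterion" --star all` (19 rows;
only Bombieri 2000 relevant); local searchd,
OpenAlex, S2, arXiv remote unavailable t  [refs: 10.1006/jnth.1999.2392, 10.1002/cpa.10089, 10.1017/9781108178266, 10.1142/s1793042112500327, 2411.05095, 2012.07781, 2509.17600, 2003.10771, 2210.01684, math/9809119, doi:10.1006/jnth.1999.2392, doi:10.1002/cpa.10089, doi:10.1017/9781108178266, doi:10.1142/s1793042112500327, CarneiroMilinovichSoundararajan2019, BondarenkoRadchenkoSeip2020, ChirreGoncalvesLaat2018]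

Barriers (technique_class: Weil-positivity, LP-duality, Fourier-optimization): - technique_class: Weil-positivity, LP-duality, Fourier-optimization
- Literature.Barriers.RiemannHypothesis.DiamondMontgomeryVorhauer2006_thm1: the statement USES
integrality — the sign constraints sit at log n for the rational integers and W_ar is ζ's exact
Γ-data; for a Beurling system neither the node set nor rigidity K = {Λ} survives (Cor noE: even
dropping the prime/composite distinction at the nodes breaks (S♭)); rev 7 honest caveat: the
criterion X ⇒ RH (the deliverable) uses integrality through the fake PNT / Chebyshev / Landau steps
of the landed magnification chain, while nothing in the route supplies a positivity MECHANISM for X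
itself — node spacing alone (shared by Beurling systems) cannot, and the landed negatives say X is
false without positive-definiteness or without node signs; that is why X is the named bridge
hypothesis and not a crux.
- Literature.Barriers.RiemannHypothesis.DavenportHeilbronn: evaded — W_ar is the conductor-1,
degree-1 archimedean functional and the dual weights are constrained NONNEGATIVE on integers; DH
(conductor 5, signed coefficients) has no sign-cone analogue, and the functional equation is not
used at all.
- Literature.Barriers.RiemannHypothesis.NewmanConjecture: at finite cutoffs the unit slack gives
O(1) margins (far-field −0.763 vs −1; certified rungs to a ≤ 13/10; LP minima +0.02…+0.05 at a ≤
2.3) instead of the barely-true e^{−x} margins of ε(a) ≥ 0; it does NOT evade tightness at a = ∞ (X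
≡ RH there) — the route no longer bet

History (route lifecycle, newest last):
- 2026-08-16T16:32:04Z · rev 3: restated SignConeInequality (stmt-RiemannHypothesis-15458), SignConeOscillatory (stmt-RiemannHypothesis-15459), ConeMagnification (stmt-RiemannHypothesis-15460), SignConeDuality (stmt-RiemannHypothesis-15461), SignConeFarField (stmt-RiemannHypothesis-15462), ExactConeRigidity (stmt-RiemannHypothesis-15463), Sign (planner-rrepair-RiemannHypothesis-SignCone-9cfede98-0)
- 2026-08-17T08:57:01Z · rev 5: restated SignConeUpTo210 (stmt-RiemannHypothesis-16307) — repair: SignConeUpTo210 (stmt-RiemannHypothesis-16307, support) declared misstated/mis-filed by prover-pitem-stmt-RiemannHypothesis-16307-0 (2026-08-17T01:37Z: (planner-rrepair-RiemannHypothesis-SignCone-jud-7acbc21f-0)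
- 2026-08-17T11:56:22Z · skeleton.hides-summit: stub_offLineMoment (stmt-RiemannHypothesis-18013) ⟷ summit (accepted theorem in Summits/RiemannHypothesis/RiemannHypothesis/Theorems/SignConeOscCoherentCoreStubRHOfOffLineMoment.lean) (prover-line-stmt-RiemannHypothesis-18013-0)
- 2026-08-17T12:29:29Z · rev 7: dropped SignConeOscillatory, OscCoherentCore — route-repair (badge; unit rbadge-RiemannHypothesis-SignCone-9cfede98): answers skeleton.hides-summit on OscCoherentCore (stub_offLineMoment ⇒ RH, p158819). X ≡ (planner-rbadge-RiemannHypothesis-SignCone-9cfede98-0)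
- 2026-08-17T12:43:50Z · AUTO-CRUX (edit): SignConeInequality — hypotheses of the deciding theorem that nothing in the route derives are cruxes (planner-rbadge-RiemannHypothesis-SignCone-9cfede98-0)
- 2026-08-17T12:50:18Z · rev 9: restated Assembly (stmt-RiemannHypothesis-15465 proved) — rev 7d (route-repair badge): restate the Assembly item to the type of the certified bridge closes (the rev-2 statement was rendered BLOCKED after the drop/re-as (planner-rbadge-RiemannHypothesis-SignCone-9cfede98-0)
- 2026-08-17T12:52:06Z · AUTO-CRUX (edit): SignConeInequality — hypotheses of the deciding theorem that nothing in the route derives are cruxes (planner-rbadge-RiemannHypothesis-SignCone-9cfede98-0)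
- 2026-08-17T13:36:04Z · CLOSED superseded — superseded:route-RiemannHypothesis-WeilPos (planner-rbadge-RiemannHypothesis-SignCone-9cfede98-g2-0)

sub-problem: RiemannHypothesis · status: closed(superseded) · opened planner-plan-lens-RiemannHypothesis-resurrect2001-v2-0 2026-08-16T15:41:31Z · rev 9 · ledger route-RiemannHypothesis-SignCone
GENERATED by the gate from the ledger (D-0016/17). Provers cite these decls: `theorem foo : Summit.RiemannHypothesis.RiemannHypothesis.Theses.SignCone.<Decl> := …` in Summits/RiemannHypothesis/RiemannHypothesis/Theorems/<Name>.lean.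
-/

namespace Summit.RiemannHypothesis.RiemannHypothesis.Theses.SignCone

open scoped BigOperators Topology Manifold Classical MeasureTheory ProbabilityTheory Matrix InnerProductSpace ComplexConjugate ContinuousMap
open Filter Set Function TopologicalSpace MeasureTheory

attribute [summit_statement] _root_.Summit.RiemannHypothesis

open Summit

-- earlier SignConeInequality (stmt-RiemannHypothesis-15458, replaced 2026-08-16T16:32:04Z -> stmt-RiemannHypothesis-16301): retired by None — ∀ a : ℝ, 0 < a → ∀ (k : ℕ) (g : Fin k → ℝ → ℂ), (∀ i, Literature.NumberTheory.LFunctions.IsWeilTest (g i) ∧ tsupport (g i) ⊆ Set.Icc (-a) a) → let F : ℝ → ℂ := fun t => ∑ i, Literature.NumberTheory.LFunctions.weilConv (g i) (Literature.NumberTheory.LFunctions.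
/-- item stmt-RiemannHypothesis-16301 · crux (kind.auto-crux: conjecture-grade) · rank 0 · closed · moot by None · by planner
why it might fail: RH-equivalent IN-TREE: RH ⇒ X landed (p128354); X ⇒ RH = closes over the CLOSED ConeMagnification (W-MAG, 12:30Z) and SignConeDuality — so X is exactly as hard as RH; every registered line on the X side ends in an RH-equivalent stub (p157126, p158819); no decomposition short of W-EFFMAG.
sources: Bombieri2000Weil, Yoshida1992HermitianForms, archive:2001/summits/rh/routes/slack-weil-cone-magnification, archive:2001/summits/rh/routes/fake-explicit-formula-rigidity, Cruxes/SignConeOscillatory/STRATEGY-CENSUS.md (crux strategist r1, 2026-08-17)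
[target] X: for all a > 0 and all node-nonnegative F ∈ P(a), Re W_ar(F) ≥ −Re F(0) (unit-slack
prime-free sign-cone inequality; archive (S♭), slack-weil-cone-magnification Step 2, fefr §7). [Lean
form, rev 3 (route-repair cone, 2026-08-16): stated over Mathlib primitives only and DEFINITIONALLY
EQUAL (`Iff.rfl`, Sketch.lean attached as evidence) to the rev-2 statement over
Literature.NumberTheory.LFunctions.{IsWeilTest, weilConv, weilReflect, weilMellin, weilPolarTerm,
weilArchTerm}: the binder `M` is weilMellin of the autocorrelation F (resp. G), `M 0 + M 1` =
weilPolarTerm, `(1/(2π))·∫ M(1/2+it)·Re ψ(1/4+it/2) dt − F 0·log π` = weilArchTerm; provers may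
`show` the Literature form and use its API.] -/
@[route_item "route-RiemannHypothesis-SignCone", crux]
def SignConeInequality : Prop :=
  ∀ a : ℝ, 0 < a → ∀ (k : ℕ) (g : Fin k → ℝ → ℂ), (∀ i, (ContDiff ℝ ((⊤ : ℕ∞) : WithTop ℕ∞) (g i) ∧ HasCompactSupport (g i)) ∧ tsupport (g i) ⊆ Set.Icc (-a) a) → let F : ℝ → ℂ := fun t => ∑ i, MeasureTheory.convolution (g i) (fun u => (starRingEnd ℂ) ((g i) (-u))) (ContinuousLinearMap.mul ℂ ℂ) MeasureTheory.MeasureSpace.volume t; (∀ n : ℕ, 2 ≤ n → 0 ≤ (F (Real.log n)).re) → let M : ℂ → ℂ := fun s => ∫ u : ℝ, F u * Complex.exp ((s - 1 / 2) * u); -(F 0).re ≤ (M 0 + M 1 + ((1 / (2 * Real.pi) : ℂ) * (∫ t : ℝ, M (1 / 2 + t * Complex.I) * ((Complex.digamma (1 / 4 + t / 2 * Complex.I)).re : ℂ)) - F 0 * (Real.log Real.pi : ℂ))).re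

-- earlier ConeMagnification (stmt-RiemannHypothesis-15460, replaced 2026-08-16T16:32:04Z -> stmt-RiemannHypothesis-16303): retired by None — (∀ a : ℝ, 0 < a → ∃ c : ℕ → ℝ, (∀ n, 0 ≤ c n) ∧ c 1 = 0 ∧ ∀ g : ℝ → ℂ, Literature.NumberTheory.LFunctions.IsWeilTest g → tsupport g ⊆ Set.Icc (-a) a → let G : ℝ → ℂ := Literature.NumberTheory.LFunctions.weilConv g (Literature.NumberTheory.LFunctions.weilReflect
/-- item stmt-RiemannHypothesis-16303 · crux · rank 3 · closed · proved by Summit.RiemannHypothesis.RiemannHypothesis.Cruxes.ConeMagnification.Sketch.ConeMagnification_of @ 6a42462267ca (prover) · by planner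
why it might fail: LANDED modulo SlackDesign (ConeMagnification_of_slackDesign); if SlackDesign fails on exotic infinite-support cone members the chain needs the ¬RH form (stub_designOfOffline) or W-EFFMAG's unformalised triple-exponential tower — a gap there leaves X possibly strictly weaker than RH.
sources: Bombieri2000Weil, archive:2001/summits/rh-w-magnification/free/y1 (Thm 1.2, upheld 2026-08-08), archive:2001/summits/rh-w-kt-nonempty/free/y2, archive:2001/summits/rh-w-effmag/free/y2 (upheld 2026-08-09), archive:2001/summits/rh/routes/slack-weil-cone-magnification, Theorems/SignConeConeMagnificationSplit.lean (ConeMagnification_of_slackDesign, landed)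
[crux] MAGNIFICATION ON THE SLACK CONES: if at every cutoff a > 0 some nonnegative integer-supported
weight c_a (c_a(1) = 0) has fake Weil form W_ar − P_{c_a} ≥ −‖g‖₂² on all Weil tests g supported in
[−a, a], then RH. 2001 proofs: (i) K♭_a compact convex and decreasing in a ⇒ ∩_a K♭_a ≠ ∅ ⇒ W-MAG
Thm 1.2 (c ∈ K^{(M)} ⇒ Σ_p (log p − c(p))₊ p^{−1/2} ≤ 2M ⇒ M-robust Landau transfer ⇒ RH; two
independent refereed-internal proofs, Lean spines MagDeficit / KtBricks GREEN over interfaces); (ii)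
directly by W-EFFMAG (off-line zero β₀+iγ₀ ⇒ K_a^{(1)} = ∅ for a ≥ A(1,β₀,γ₀), explicit
triple-exponential tower). [difficulty: L] [Lean form, rev 3 (route-repair cone, 2026-08-16): stated
over Mathlib primitives only and DEFINITIONALLY EQUAL (`Iff.rfl`, Sketch.lean attached as evidence)
to the rev-2 statement over Literature.NumberTheory.LFunctions.{IsWeilTest, weilConv, weilReflect,
weilMellin, weilPolarTerm, weilArchTerm}: the binder `M` is weilMellin of the autocorrelation F
(resp. G), `M 0 + M 1` = weilPolarTerm, `(1/(2π))·∫ M(1/2+it)·Re ψ(1/4+it/2) dt − F 0·log π` =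
weilArchTerm; provers may `show` the Literature form and use its API.] -/
@[route_item "route-RiemannHypothesis-SignCone", crux]
def ConeMagnification : Prop :=
  (∀ a : ℝ, 0 < a → ∃ c : ℕ → ℝ, (∀ n, 0 ≤ c n) ∧ c 1 = 0 ∧ ∀ g : ℝ → ℂ, (ContDiff ℝ ((⊤ : ℕ∞) : WithTop ℕ∞) g ∧ HasCompactSupport g) → tsupport g ⊆ Set.Icc (-a) a → let G : ℝ → ℂ := MeasureTheory.convolution g (fun u => (starRingEnd ℂ) (g (-u))) (ContinuousLinearMap.mul ℂ ℂ) MeasureTheory.MeasureSpace.volume; let M : ℂ → ℂ := fun s => ∫ u : ℝ, G u * Complex.exp ((s - 1 / 2) * u); -(∫ t, ‖g t‖ ^ 2) ≤ (M 0 + M 1 + ((1 / (2 * Real.pi) : ℂ) * (∫ t : ℝ, M (1 / 2 + t * Complex.I) * ((Complex.digamma (1 / 4 + t / 2 * Complex.I)).re : ℂ)) - G 0 * (Real.log Real.pi : ℂ)) - ∑' n : ℕ, ((c n : ℝ) : ℂ) / (Real.sqrt n : ℂ) * (G (Real.log n) + G (-Real.log n))).re) → Summit.RiemannHypothesis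

-- earlier SignConeDuality (stmt-RiemannHypothesis-15461, replaced 2026-08-16T16:32:04Z -> stmt-RiemannHypothesis-16304): retired by None — ∀ a : ℝ, 0 < a → (∀ (k : ℕ) (g : Fin k → ℝ → ℂ), (∀ i, Literature.NumberTheory.LFunctions.IsWeilTest (g i) ∧ tsupport (g i) ⊆ Set.Icc (-a) a) → let F : ℝ → ℂ := fun t => ∑ i, Literature.NumberTheory.LFunctions.weilConv (g i) (Literature.NumberTheory.LFunctions.we
/-- item stmt-RiemannHypothesis-16304 · crux · rank 4 · closed · proved by Summit.RiemannHypothesis.RiemannHypothesis.Theorems.SignConeDuality.SignConeDuality_of @ b13840cce207 (prover) · by planner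
why it might fail: instantiating the abstract minimax needs finiteness of μ(a) (a-priori bound −8 sinh a − 6), a Slater point in P(a) and boundedness of dual superlevel sets; the n = 0, 1 nodes and the weight 1/√n must match `weilPrimeTerm` exactly or the unit constant shifts.
sources: archive:2001/summits/rh/routes/fake-explicit-formula-rigidity (paper Thm 7.2, lean FefrMinimaxRow + FefrDualUsc + FefrConicCaratheodory GREEN), Shapiro2001 conic linear duality (in Semi-Infinite Programming, Kluwer 2001, Props 3.1 and 3.4), Bombieri2000Weil
[crux] CONIC DUALITY AT EACH CUTOFF: the unit-slack sign-cone inequality at cutoff a implies the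
existence of a nonnegative weight c on ℕ (c(1) = 0; only n < e^{2a} matter) with Re[W_ar(g⋆g̃) − Σ_n
c(n) n^{−1/2}((g⋆g̃)(log n) + (g⋆g̃)(−log n))] ≥ −∫|g|² for every Weil test g supported in [−a, a]
(μ(a) = max_{c ≥ 0} ε_c(a), archive fefr Thm 7.2(2): separation with a Slater point, dual attainment
by USC + compact superlevel sets; no primal attainment needed). [difficulty: M] [Lean form, rev 3
(route-repair cone, 2026-08-16): stated over Mathlib primitives only and DEFINITIONALLY EQUAL
(`Iff.rfl`, Sketch.lean attached as evidence) to the rev-2 statement over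
Literature.NumberTheory.LFunctions.{IsWeilTest, weilConv, weilReflect, weilMellin, weilPolarTerm,
weilArchTerm}: the binder `M` is weilMellin of the autocorrelation F (resp. G), `M 0 + M 1` =
weilPolarTerm, `(1/(2π))·∫ M(1/2+it)·Re ψ(1/4+it/2) dt − F 0·log π` = weilArchTerm; provers may
`show` the Literature form and use its API.] -/
@[route_item "route-RiemannHypothesis-SignCone", crux]
def SignConeDuality : Prop :=
  ∀ a : ℝ, 0 < a → (∀ (k : ℕ) (g : Fin k → ℝ → ℂ), (∀ i, (ContDiff ℝ ((⊤ : ℕ∞) : WithTop ℕ∞) (g i) ∧ HasCompactSupport (g i)) ∧ tsupport (g i) ⊆ Set.Icc (-a) a) → let F : ℝ → ℂ := fun t => ∑ i, MeasureTheory.convolution (g i) (fun u => (starRingEnd ℂ) ((g i) (-u))) (ContinuousLinearMap.mul ℂ ℂ) MeasureTheory.MeasureSpace.volume t; (∀ n : ℕ, 2 ≤ n → 0 ≤ (F (Real.log n)).re) → let M : ℂ → ℂ := fun s => ∫ u : ℝ, F u * Complex.exp ((s - 1 / 2) * u); -(F 0).re ≤ (M 0 + M 1 + ((1 / (2 * Real.pi)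 : ℂ) * (∫ t : ℝ, M (1 / 2 + t * Complex.I) * ((Complex.digamma (1 / 4 + t / 2 * Complex.I)).re : ℂ)) - F 0 * (Real.log Real.pi : ℂ))).re) → ∃ c : ℕ → ℝ, (∀ n, 0 ≤ c n) ∧ c 1 = 0 ∧ ∀ g : ℝ → ℂ, (ContDiff ℝ ((⊤ : ℕ∞) : WithTop ℕ∞) g ∧ HasCompactSupport g) → tsupport g ⊆ Set.Icc (-a) a → let G : ℝ → ℂ := MeasureTheory.convolution g (fun u => (starRingEnd ℂ) (g (-u))) (ContinuousLinearMap.mul ℂ ℂ) MeasureTheory.MeasureSpace.volume; let M : ℂ → ℂ := fun s => ∫ u : ℝ, G u * Complex.exp ((s - 1 / 2) * u); -(∫ t, ‖g t‖ ^ 2) ≤ (M 0 + M 1 + ((1 / (2 * Real.pi) : ℂ) * (∫ t : ℝ, M (1 / 2 + t * Complex.I) * ((Complex.digamma (1 / 4 + t / 2 * Complex.I)).re : ℂ)) - G 0 * (Real.log Real.pi : ℂ)) - ∑' n : ℕ, ((c n : ℝ) : ℂ) / (Real.sqrt n : ℂ) * (G (Real.log n) + G (-Real.log n))).re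

/-- item stmt-RiemannHypothesis-18009 · crux · rank 4 · closed · proved by Summit.RiemannHypothesis.RiemannHypothesis.Cruxes.SlackDesign.RealCombType.SlackDesign_of @ 9b30f68467b7 (prover) · by planner
why it might fail: Asserts design data for EVERY unit-slack weight, incl. exotic infinite-support RH-world cone members (SlackBall Λ+m, Σ|m|/√n ≤ ½ attains AX-C's ½, p130627): one with c−Λ ∉ ℓ¹(1/n) or beating ½ refutes it (repair: ¬RH form stub_designOfOffline); G1's printed proof absent, comb evaluation unverified.
sources: Bombieri2000Weil, BondarenkoSeip2017, MontgomeryVaughan2007, Titchmarsh1986, archive:2001/summits/rh-w-magnification/free/y1 (Thm 3.1, prop:abs, eq:LO; upheld 2026-08-08), archive:2001/summits/rh-w-composite-vanishing/free/y1 (Prop 2.4, App. A, Lemmas 3.2–3.5)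
[crux] UNIT SLACK ⇒ DESIGN DATA — the analytic core of the 2001 magnification theorem W-MAG (Thm 3.1
/ Prop 4.3 [prop:abs] / eq:LO at slack M = 1), zero-free (no ¬RH, no zero of ζ in the statement).
For a weight c ≥ 0 on ℕ, c 1 = 0, with UNIT SLACK −‖g‖₂² of its fake Weil form W_ar − P_c against
EVERY Weil test g (uniform cone; `ConeMagnification` reduces to one such weight by the LANDED
slack-cone compactness coneMagnification_of_uniform, p129201), given the two derivable data Σ c(n)
n^{-σ} < ∞ (σ > 1; LANDED stub_chebyshev ∘ stub_fakePNT) and the Carathéodory majorant of F = L_c −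
1/(s−1) on re s > 1/2 (LANDED stub_cara): (AX-A) Σ|c(n) − Λ(n)|/n < ∞; (AX-B) the composite-mass
series Σ_{n composite, not a prime power} (c(n)/n)·e₂(n) < ∞, e₂(n) = Σ_{q<q′|n} τ_q τ_{q′}, τ_p =
(√p − 1)/2; (AX-C) for every finite prime set S, a : S → [0,1], phase φ: Σ_n
((c−Λ)(n)/n)·Φ_{S,a,φ}(n) ≤ 1/2 (Riesz–Euler design inequality). STATUS OF THE 2001 PROOF IN THE
TREE (referee REFEREE.md on stmt-16303, 2026-08-17): of W-MAG's 8 proof steps, S1 compactness, S2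
structure/continuation/Carathéodory, S5 design algebra ([CV] Lemma 3.2, §4, W-MAG L5.1–5.3:
GcdFormProfile p143252, ResonatorTypeDesigns p1436 -/
@[route_item "route-RiemannHypothesis-SignCone"]
def SlackDesign : Prop :=
  ∀ c : ℕ → ℝ, (∀ n, 0 ≤ c n) → c 1 = 0 → (∀ g : ℝ → ℂ, (ContDiff ℝ ((⊤ : ℕ∞) : WithTop ℕ∞) g ∧ HasCompactSupport g) → let G : ℝ → ℂ := MeasureTheory.convolution g (fun u => (starRingEnd ℂ) (g (-u))) (ContinuousLinearMap.mul ℂ ℂ) MeasureTheory.MeasureSpace.volume; let M : ℂ → ℂ := fun s => ∫ u : ℝ, G u * Complex.exp ((s - 1 / 2) * u); -(∫ t, ‖g t‖ ^ 2) ≤ (M 0 + M 1 + ((1 / (2 * Real.pi) : ℂ) * (∫ t : ℝ, M (1 / 2 + t * Complex.I) * ((Complex.digamma (1 / 4 + t / 2 * Complex.I)).re : ℂ)) - G 0 * (Real.log Real.pi : ℂ)) - ∑' n : ℕ, ((c n : ℝ) : ℂ) / (Real.sqrt n : ℂ) * (G (Real.log n) + G (-Real.log n))).re) → (∀ σ :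 ℝ, 1 < σ → LSeriesSummable (fun n => ((c n : ℝ) : ℂ)) σ) → (∃ F : ℂ → ℂ, DifferentiableOn ℂ F {s : ℂ | 1 / 2 < s.re} ∧ (∀ s : ℂ, 1 < s.re → F s = LSeries (fun n => ((c n : ℝ) : ℂ)) s - 1 / (s - 1)) ∧ ∀ s : ℂ, 1 / 2 < s.re → (F s).re ≤ 1 / 2 + (1 / s).re + 1 / (2 * Real.pi) * (∫ v : ℝ, (Complex.digamma (1 / 4 + v / 2 * Complex.I)).re * ((s.re - 1 / 2) / ((s.re - 1 / 2) ^ 2 + (s.im - v) ^ 2))) - Real.log Real.pi / 2) → Summable (fun n : ℕ => |c n - ArithmeticFunction.vonMangoldt n| / (n : ℝ)) ∧ Summable (fun n : ℕ => if 2 ≤ n ∧ ¬ IsPrimePow n then c n / (n : ℝ) * (∑ q ∈ n.primeFactors, ∑ q' ∈ n.primeFactors.filter (fun q' => q < q'), ((Real.sqrt q - 1) / 2) * ((Real.sqrt q' - 1) / 2)) else 0) ∧ (∀ S : Finset ℕ, (∀ p ∈ S, p.Prime) → ∀ a : ℕ → ℝ, (∀ p ∈ S, 0 ≤ a p ∧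 a p ≤ 1) → ∀ φ : ℝ, (∑' n : ℕ, (c n - ArithmeticFunction.vonMangoldt n) / (n : ℝ) * (if ∀ p ∈ S, ¬ (p ^ 2 ∣ n) then Real.sqrt (∏ p ∈ S.filter (· ∣ n), (p : ℝ)) * (∏ p ∈ S.filter (· ∣ n), a p) * (1 / 2) ^ (S.filter (· ∣ n)).card * Real.cos (((S.filter (· ∣ n)).card : ℝ) * φ) else 0)) ≤ 1 / 2)

-- earlier SignConeFarField (stmt-RiemannHypothesis-15462, replaced 2026-08-16T16:32:04Z -> stmt-RiemannHypothesis-16305): retired by None — ∀ a : ℝ, 0 < a → ∀ (k : ℕ) (g : Fin k → ℝ → ℂ), (∀ i, Literature.NumberTheory.LFunctions.IsWeilTest (g i) ∧ tsupport (g i) ⊆ Set.Icc (-a) a) → let F : ℝ → ℂ := fun t => ∑ i, Literature.NumberTheory.LFunctions.weilConv (g i) (Literature.NumberTheory.LFunctions.we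
/-- item stmt-RiemannHypothesis-16305 · crux · rank 9 · closed · proved by Summit.RiemannHypothesis.RiemannHypothesis.Theorems.SignConeFarField.SignConeFarField_of @ 52019178bb60 (prover) · by planner
why it might fail: RH-implied (only ¬RH refutes it); unconditionally the crude weight-bookkeeping margin −0.763 > −1 must be made rigorous for all smooth hermitian p.d. F (t→0⁺ limit of (2F(0)−S)w, sign of w on (0,0.2813), |F|≤F(0)); an O(1) slip in the arch normalisation would sink it below −1.
sources: Bombieri2000Weil, ConnesConsani2021, archive:2001/summits/rh-w-prime-free-inequality/free/x3 (NF rows)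
[support] the unit-slack sign-cone inequality for FAR-FIELD-NONNEGATIVE tests (Re F(t) ≥ 0 for all
|t| ≥ log 2): provable now by weight bookkeeping in Bombieri's form of W_ar
(`weilArchTermBombieri_eq_weilArchTerm`): with S(t) = 2Re F(t) (hermitian F), |F| ≤ F(0), w(t) =
e^{t/2} + e^{−t/2} − e^{t/2}/(2 sinh t) (< 0 on (0, 0.2813), > 0 after), Re W_ar(F) ≥ F(0)[∫₀^{log
2}(2w + 1/sinh) − (log 4π + γ) − 4∫_{0.2813}^{log 2} w + ∫_{log 2}^∞ dt/sinh t] = F(0)[2.4596 −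
3.1082 − 1.2127 + 1.0986] = −0.763 F(0) > −F(0). [difficulty: provable-now] [Lean form, rev 3
(route-repair cone, 2026-08-16): stated over Mathlib primitives only and DEFINITIONALLY EQUAL
(`Iff.rfl`, Sketch.lean attached as evidence) to the rev-2 statement over
Literature.NumberTheory.LFunctions.{IsWeilTest, weilConv, weilReflect, weilMellin, weilPolarTerm,
weilArchTerm}: the binder `M` is weilMellin of the autocorrelation F (resp. G), `M 0 + M 1` =
weilPolarTerm, `(1/(2π))·∫ M(1/2+it)·Re ψ(1/4+it/2) dt − F 0·log π` = weilArchTerm; provers may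
`show` the Literature form and use its API.] -/
@[route_item "route-RiemannHypothesis-SignCone"]
def SignConeFarField : Prop :=
  ∀ a : ℝ, 0 < a → ∀ (k : ℕ) (g : Fin k → ℝ → ℂ), (∀ i, (ContDiff ℝ ((⊤ : ℕ∞) : WithTop ℕ∞) (g i) ∧ HasCompactSupport (g i)) ∧ tsupport (g i) ⊆ Set.Icc (-a) a) → let F : ℝ → ℂ := fun t => ∑ i, MeasureTheory.convolution (g i) (fun u => (starRingEnd ℂ) ((g i) (-u))) (ContinuousLinearMap.mul ℂ ℂ) MeasureTheory.MeasureSpace.volume t; (∀ n : ℕ, 2 ≤ n → 0 ≤ (F (Real.log n)).re) → (∀ t : ℝ, Real.log 2 ≤ |t| → 0 ≤ (F t).re) → let M : ℂ → ℂ := fun s => ∫ u : ℝ, F u * Complex.exp ((s - 1 / 2) * u); -(F 0).re ≤ (M 0 + M 1 + ((1 / (2 * Real.pi) : ℂ) * (∫ t : ℝ, M (1 / 2 + t * Complex.I) * ((Complex.digamma (1 / 4 + t / 2 * Complex.I)).re : ℂ)) - F 0 * (Real.log Real.pi : ℂ))).re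

/-- item stmt-RiemannHypothesis-18012 · support · rank 5 · closed · moot by None · by planner
why it might fail: The completion-cost bound is heuristic: at T = 3 the predicted margin (1+T)/π − 1 ≈ 0.27 may be eaten by stationary-phase errors O((kX)^(−1/2)) at X = e^3 ≈ 20 and by the near-node window terms; and one window can still host a short coherent chirp packet fed by a large value of ζ (E-harvest).
sources: Cruxes/SignConeOscillatory/Ideas/lattice-chirp-completion.md (crux idea r1, ideator 1), Titchmarsh1986, CarneiroMilinovichSoundararajan2019, arXiv:2003.10771, BondarenkoRadchenkoSeip2020, Bombieri2000Weil
[crux] the unit-slack sign-cone inequality for the SINGLE-HIGH-WINDOW (incoherent) oscillatory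
class: node-nonnegative F ∈ P(a) whose far-field negativity {|t| ≥ log 2 : Re F(t) < 0} lies in ONE
window T ≤ |t| ≤ T + log 2 with T ≥ 3 (x = e^T ≥ 20: inside, the nodes log n are an e^{−T}-dense
image of the integer LATTICE [X, 2X]). This is the sub-class on which the route's uncertainty lever
is claimed to bite — the judge's 'per-gap uncertainty inequality closing a nontrivial oscillatory
sub-class' — in the sharpened form of crux idea `lattice-chirp-completion`
(Cruxes/SignConeOscillatory/Ideas/lattice-chirp-completion.md): (1) Poisson summation of the node
functional in x = e^t, window by window, Σ_n n^{−1/2} w(n/X) F(log n) = (1/2π) ∫ σ_F(ξ) Σ_k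
𝔨_{X,k}(ξ) dξ exactly (σ_F = F̂(1/2+i·) ≥ 0; typed as WindowedAliasingIdentity in
Cruxes/SignConeOscillatory/SketchIdeator1.lean, rc 0); (2) stationary phase for the windowed chirps,
|𝔨_{X,k}(ξ)| = w(ξ/2πkX)/√k + O((kX)^{−1/2}) on the octave 2πk[X,2X] (ChirpKernelModulus; tree:
Literature stationaryPhase, VdC.weightedBProcess, vanDerCorput_lemma47, RiemannSiegelPhase — all
proved); (3) the load-bearing COMPLETION-COST inequality: negativity -/
@[route_item "route-RiemannHypothesis-SignCone"]
def OscSingleWindow : Prop :=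
  ∀ a : ℝ, 0 < a → ∀ (k : ℕ) (g : Fin k → ℝ → ℂ), (∀ i, (ContDiff ℝ ((⊤ : ℕ∞) : WithTop ℕ∞) (g i) ∧ HasCompactSupport (g i)) ∧ tsupport (g i) ⊆ Set.Icc (-a) a) → let F : ℝ → ℂ := fun t => ∑ i, MeasureTheory.convolution (g i) (fun u => (starRingEnd ℂ) ((g i) (-u))) (ContinuousLinearMap.mul ℂ ℂ) MeasureTheory.MeasureSpace.volume t; (∀ n : ℕ, 2 ≤ n → 0 ≤ (F (Real.log n)).re) → (∃ T : ℝ, 3 ≤ T ∧ ∀ t : ℝ, Real.log 2 ≤ |t| → (F t).re < 0 → T ≤ |t| ∧ |t| ≤ T + Real.log 2) → (∃ t : ℝ, Real.log 2 ≤ |t| ∧ (F t).re < 0) → let M : ℂ → ℂ := fun s => ∫ u : ℝ, F u * Complex.exp ((s - 1 / 2) * u); -(F 0).re ≤ (M 0 + M 1 + ((1 / (2 * Real.pi) : ℂ) * (∫ t : ℝ, M (1 / 2 + t * Complex.I) * ((Complex.digamma (1 / 4 + t / 2 * Complex.I)).re : ℂ)) - F 0 * (Real.log Real.pi : ℂ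))).re

-- earlier ExactConeRigidity (stmt-RiemannHypothesis-15463, replaced 2026-08-16T16:32:04Z -> stmt-RiemannHypothesis-16306): retired by None — (∀ a : ℝ, 0 < a → ∀ (k : ℕ) (g : Fin k → ℝ → ℂ), (∀ i, Literature.NumberTheory.LFunctions.IsWeilTest (g i) ∧ tsupport (g i) ⊆ Set.Icc (-a) a) → let F : ℝ → ℂ := fun t => ∑ i, Literature.NumberTheory.LFunctions.weilConv (g i) (Literature.NumberTheory.LFunctions.
/-- item stmt-RiemannHypothesis-16306 · support · rank 9 · closed · proved by Summit.RiemannHypothesis.RiemannHypothesis.Theorems.exactConeRigidity_proof @ 1482809c10f8 (prover) · by planner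
sources: archive:2001/summits/rh-w-composite-vanishing/free/y1 (upheld 2026-08-08), archive:2001/summits/rh-w-signed-rigidity/free/y1 (upheld 2026-08-09), archive:2001/summits/rh/routes/fake-explicit-formula-rigidity (Thms A+B+C), Bombieri2000Weil
[support] the EXACT chain (alternative deciding path, 2001 (R)): if the sign-cone inequality holds
WITHOUT slack at every cutoff (Re W_ar(F) ≥ 0 on node-nonnegative P(a) for all a) then RH — via
duality K_a ≠ ∅ ∀a, compactness, rigidity K = {Λ} (W-COMP: c ∈ K vanishes off prime powers; W-SRPP:
c = Λ + h on prime powers with W_c ≥ 0 forces h = 0) and the in-tree Weil criterion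
`weil_criterion_holds`. [difficulty: L] [Lean form, rev 3 (route-repair cone, 2026-08-16): stated
over Mathlib primitives only and DEFINITIONALLY EQUAL (`Iff.rfl`, Sketch.lean attached as evidence)
to the rev-2 statement over Literature.NumberTheory.LFunctions.{IsWeilTest, weilConv, weilReflect,
weilMellin, weilPolarTerm, weilArchTerm}: the binder `M` is weilMellin of the autocorrelation F
(resp. G), `M 0 + M 1` = weilPolarTerm, `(1/(2π))·∫ M(1/2+it)·Re ψ(1/4+it/2) dt − F 0·log π` =
weilArchTerm; provers may `show` the Literature form and use its API.] -/
@[route_item "route-RiemannHypothesis-SignCone"]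
def ExactConeRigidity : Prop :=
  (∀ a : ℝ, 0 < a → ∀ (k : ℕ) (g : Fin k → ℝ → ℂ), (∀ i, (ContDiff ℝ ((⊤ : ℕ∞) : WithTop ℕ∞) (g i) ∧ HasCompactSupport (g i)) ∧ tsupport (g i) ⊆ Set.Icc (-a) a) → let F : ℝ → ℂ := fun t => ∑ i, MeasureTheory.convolution (g i) (fun u => (starRingEnd ℂ) ((g i) (-u))) (ContinuousLinearMap.mul ℂ ℂ) MeasureTheory.MeasureSpace.volume t; (∀ n : ℕ, 2 ≤ n → 0 ≤ (F (Real.log n)).re) → let M : ℂ → ℂ := fun s => ∫ u : ℝ, F u * Complex.exp ((s - 1 / 2) * u); 0 ≤ (M 0 + M 1 + ((1 / (2 * Real.pi) : ℂ) * (∫ t : ℝ, M (1 / 2 + t * Complex.I) * ((Complex.digamma (1 / 4 + t / 2 * Complex.I)).re : ℂ)) - F 0 * (Real.log Real.pi : ℂ))).re) → Summit.RiemannHypothesis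

-- earlier SignConeUpTo210 (stmt-RiemannHypothesis-15464, replaced 2026-08-16T16:32:04Z -> stmt-RiemannHypothesis-16307): retired by None — ∀ a : ℝ, 0 < a → a ≤ Real.log 210 / 2 → ∀ (k : ℕ) (g : Fin k → ℝ → ℂ), (∀ i, Literature.NumberTheory.LFunctions.IsWeilTest (g i) ∧ tsupport (g i) ⊆ Set.Icc (-a) a) → let F : ℝ → ℂ := fun t => ∑ i, Literature.NumberTheory.LFunctions.weilConv (g i) (Literature.Numb
-- earlier SignConeUpTo210 (stmt-RiemannHypothesis-16307, replaced 2026-08-17T08:57:01Z -> stmt-RiemannHypothesis-17940): retired by None — ∀ a : ℝ, 0 < a → a ≤ Real.log 210 / 2 → ∀ (k : ℕ) (g : Fin k → ℝ → ℂ), (∀ i, (ContDiff ℝ ((⊤ : ℕ∞) : WithTop ℕ∞) (g i) ∧ HasCompactSupport (g i)) ∧ tsupport (g i) ⊆ Set.Icc (-a) a) → let F : ℝ → ℂ := fun t => ∑ i, MeasureTheory.convolution (g i) (fun u => (starRi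
/-- item stmt-RiemannHypothesis-17940 · support · rank 9 · closed · moot by None · by planner
sources: archive:2001/summits/rh/routes/fake-explicit-formula-rigidity (Thm S, pincert), archive:2001/summits/rh-w-prime-free-inequality/free/x3 (NFDuality.lean, 303292-cell Arb certificate), ConnesConsani2021
[support] the UNIT-SLACK sign-cone inequality (−Re F(0) ≤ Re W_ar(F) for node-nonnegative F ∈ P(a))
for all cutoffs a ≤ (log 210)/2 ≈ 2.674 — the next certified-computation RUNG above the landed ones
(a ≤ 4/5 with c = 0; a ≤ 1 with fake primes on {2,3,4,5,7}, pwCert1; a ≤ 13/10 with fake weights on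
n = 3..12, pwCert13s = item OscUpToThirteenTenths): exhibit ONE nonnegative fake weight c on n ≤ 210
(expected ≈ Λ(n) on the prime powers, ≈ 0 on composites, per the calibration LPs j020380/j020462)
and certify the pointwise density 0 ≤ Re ψ(1/4+iy/2) − log π + 1 + Ê_χ(y) − Σ_n a_n cos(y log n) for
every real y with the landed fast checker (SignConePointwiseCheckerFast/…Sound, SOS tail
SignConePointwiseSOSTail) to a height Y₀ ≍ 10³, then conclude by SignConeUnitSlackReduction
(`signConeOscillatory_upTo_of_fakeWeight_unitSlack` pattern). O(1) margin (unit slack; the LP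
minimum of W_ar/F(0) on the node-nonnegative cone is ≈ +0.02…+0.05 at a ≤ 2.3), so finite precision
suffices; intermediate rungs a ≤ 3/2 and 2 first. RESTATED in rev 5 (judge-repair 2026-08-17) from
the EXACT (slack-free) form, which a prover declared misstated/mis-filed (2026-08-17T01:37Z): the
exact cone is numerically ma -/
@[route_item "route-RiemannHypothesis-SignCone"]
def SignConeUpTo210 : Prop :=
  ∀ a : ℝ, 0 < a → a ≤ Real.log 210 / 2 → ∀ (k : ℕ) (g : Fin k → ℝ → ℂ), (∀ i, (ContDiff ℝ ((⊤ : ℕ∞) : WithTop ℕ∞) (g i) ∧ HasCompactSupport (g i)) ∧ tsupport (g i) ⊆ Set.Icc (-a) a) → let F : ℝ → ℂ := fun t => ∑ i, MeasureTheory.convolution (g i) (fun u => (starRingEnd ℂ) ((g i) (-u))) (ContinuousLinearMap.mul ℂ ℂ) MeasureTheory.MeasureSpace.volume t; (∀ n : ℕ, 2 ≤ n → 0 ≤ (F (Real.log n)).re) → let M : ℂ → ℂ := fun s => ∫ u : ℝ, F u * Complex.exp ((s - 1 / 2) * u); -(F 0).re ≤ (M 0 + M 1 + ((1 / (2 * Real.pi)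 : ℂ) * (∫ t : ℝ, M (1 / 2 + t * Complex.I) * ((Complex.digamma (1 / 4 + t / 2 * Complex.I)).re : ℂ)) - F 0 * (Real.log Real.pi : ℂ))).re

/-- item stmt-RiemannHypothesis-18010 · support · rank 9 · closed · proved by Summit.RiemannHypothesis.RiemannHypothesis.Theorems.magnificationOfSlackDesign_proof @ 29e815037e45 (prover) · by planner
why it might fail: None in substance — LANDED (ConeMagnification_of_slackDesign, axioms {propext, Classical.choice, Quot.sound}); only a rendering-order slip (this decl must follow SlackDesign and ConeMagnification in the route file) could bounce the filing.
sources: Theorems/SignConeConeMagnificationSplit.lean (landed: ConeMagnification_of_subs, ConeMagnification_of_slackDesign), archive:2001/summits/rh-w-magnification/free/y1 (Lemma 2.5, Thm 2.4, §5 Prop 5.3/Thm 5.4, Prop 6.2; upheld 2026-08-08), reserve/prior-2001/Prior/RiemannHypothesis/RiemannHypothesis/Rh_WMagnificationY1_MagDeficit.lean (deficit_summable), Bombieri2000Weil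
[support] (binder of `closes`; LANDED) SlackDesign → ConeMagnification: the 2001 magnification chain
CERTIFIED modulo its analytic core — LANDED as
`Summit.RiemannHypothesis.RiemannHypothesis.Theorems.SignConeConeMagnification.ConeMagnification_of_slackDesign`
(Theorems/SignConeConeMagnificationSplit.lean, = ConeMagnification_of_subs ∘ stub_deficitOfDesign;
crux strategist cstrat-stmt-RiemannHypothesis-16303-r1, SPLIT-PROPOSAL.md), composing seven landed
theorems: slack-cone compactness coneMagnification_of_uniform (p129201; W-MAG Lemma 2.5 / swcm Thm
2.1: one weight for all cutoffs), stub_fakePNT (p130740), stub_chebyshev (p131015),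
stub_continuation (p130893), stub_pdLaplace (p132066), stub_cara (p133591) (W-MAG Thm 2.4 / swcm Thm
A♭: fake PNT, L_c − 1/(s−1) continued to re s > 1/2 with the Carathéodory majorant), the finite
deficit spine stub_deficitOfDesign (p137772 = W-MAG §5 Prop 5.3 + Thm 5.4, ported from the prior
programme's kernel-checked Rh_WMagnificationY1_MagDeficit.lean: design data ⇒ Σ_p (log p − c(p))₊
p^{−σ} < ∞ for every σ > 1/2) and the M-robust Landau transfer stub_transfer (p130783; W-MAG Prop
6.2). TYPE-IDENTICAL to this item (planner Sketch.lean: `example : M -/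
@[route_item "route-RiemannHypothesis-SignCone"]
def MagnificationOfSlackDesign : Prop :=
  SlackDesign → ConeMagnification

/-- item stmt-RiemannHypothesis-18011 · support · rank 9 · closed · proved by Summit.RiemannHypothesis.RiemannHypothesis.Theorems.oscUpToThirteenTenths_proof @ 874b54531d8d (prover) · by planner
why it might fail: None in substance — LANDED (signConeOscillatory_upTo_thirteen_tenths, kernel-checked certificate pwCert13s); only a transcription slip between this item and the theorem's type could delay the one-line closing (checked byte-identical, Sketch.lean rc 0).
sources: Theorems/SignConeSignConeOscillatoryUpToThirteenTenths.lean (landed), Theorems/SignConePointwiseCertThirteenTenths.lean (pwCert13s), ConnesConsani2021, Bombieri2000Weil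
[support] (binder of `closes`; LANDED) the oscillatory crux UNCONDITIONALLY for all cutoffs a ≤
13/10 (window (−2.6, 2.6), nodes log 2 … log 13 inside; the oscillatory class is non-empty for every
a > (log 2)/2, `oscillatoryClass_nonempty_iff`, Theorems/SignConeSignConeOscillatoryThreshold.lean —
so this is a NONTRIVIAL oscillatory sub-class, closed): LANDED as
`Summit.RiemannHypothesis.RiemannHypothesis.Theorems.SignCone.signConeOscillatory_upTo_thirteen_tenths`
(Theorems/SignConeSignConeOscillatoryUpToThirteenTenths.lean): the kernel-checked pointwise dual
certificate pwCert13s — fake weights c_n = a_n√n/2 on n = 3..12 (a = (0.60057, 0.69308, 0.42845,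
0.44084, 0.81646, 0.49376, 0.69020, 0.52193, 0.64028, 0.01028)), density 0 ≤ Re ψ(1/4 + iy/2) − log
π + 1 + Ê_χ(y) − Σ_n a_n cos(y log n) for EVERY real y (fast checker SignConePointwiseCheckerFast +
SOS tail), and the spectral identity slackFunctional_eq_spectralIntegral
(SignConePointwiseIdentity.lean); earlier rungs 4/5 (c = 0, no primes) and 1 (fake primes on
{2,3,4,5,7}). The statement is BYTE-IDENTICAL to the landed theorem's type (planner Sketch.lean:
`example : OscUpToThirteenTenths := signConeOscillatory_upTo_thirteen_tenth -/
@[route_item "route-RiemannHypothesis-SignCone"]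
def OscUpToThirteenTenths : Prop :=
  ∀ a : ℝ, 0 < a → a ≤ 13 / 10 → ∀ (k : ℕ) (g : Fin k → ℝ → ℂ), (∀ i, (ContDiff ℝ ((⊤ : ℕ∞) : WithTop ℕ∞) (g i) ∧ HasCompactSupport (g i)) ∧ tsupport (g i) ⊆ Set.Icc (-a) a) → let F : ℝ → ℂ := fun t => ∑ i, MeasureTheory.convolution (g i) (fun u => (starRingEnd ℂ) ((g i) (-u))) (ContinuousLinearMap.mul ℂ ℂ) MeasureTheory.MeasureSpace.volume t; (∀ n : ℕ, 2 ≤ n → 0 ≤ (F (Real.log n)).re) → (∃ t : ℝ, Real.log 2 ≤ |t| ∧ (F t).re < 0) → let M : ℂ → ℂ := fun s => ∫ u : ℝ, F u * Complex.exp ((s - 1 / 2) * u); -(F 0).re ≤ (M 0 + M 1 + ((1 / (2 * Real.pi) : ℂ) * (∫ t : ℝ, M (1 / 2 + t * Complex.I) * ((Complex.digamma (1 / 4 + t / 2 * Complex.I)).re : ℂ)) - F 0 * (Real.log Real.pi : ℂ))).re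

-- earlier SignConeOscillatory (stmt-RiemannHypothesis-15459, replaced 2026-08-16T16:32:04Z -> stmt-RiemannHypothesis-16302): retired by None — ∀ a : ℝ, 0 < a → ∀ (k : ℕ) (g : Fin k → ℝ → ℂ), (∀ i, Literature.NumberTheory.LFunctions.IsWeilTest (g i) ∧ tsupport (g i) ⊆ Set.Icc (-a) a) → let F : ℝ → ℂ := fun t => ∑ i, Literature.NumberTheory.LFunctions.weilConv (g i) (Literature.NumberTheory.LFunctions
/-- item stmt-RiemannHypothesis-18107 · support · rank 9 · closed · moot by None · by planner
[support] BANKED (rev 7 route-repair: ≡ SignConeInequality in-tree, p129083; RH-strength, no RH-free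
remainder; the X-content is carried by the target item = the bridge hypothesis; never to be staffed)
— the unit-slack sign-cone inequality for the OSCILLATORY class: node-nonnegative F ∈ P(a) whose
real part is negative somewhere in the far field |t| ≥ log 2 (negativity can only sit strictly
between consecutive nodes log n < t < log(n+1)). This is where an off-line zero would act (W-EFFMAG
witnesses) and where the uncertainty lever applies: depth-m negativity between nodes at height t
forces F̂-mass ≳ m at frequencies ≳ e^t·m (charged ≈ m t/4π by Re ψ) against a pole gain ≤ 2m
e^{−t/2} per gap; the residual finite window of small nodes and the cumulative (many-gap,
resonator-type) designs are the open core. [difficulty: open-problem] [Lean form, rev 3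
(route-repair cone, 2026-08-16): stated over Mathlib primitives only and DEFINITIONALLY EQUAL
(`Iff.rfl`, Sketch.lean attached as evidence) to the rev-2 statement over
Literature.NumberTheory.LFunctions.{IsWeilTest, weilConv, weilReflect, weilMellin, weilPolarTerm,
weilArchTerm}: the binder `M` is weilMellin of the autocorrelation F (r -/
@[route_item "route-RiemannHypothesis-SignCone", crux]
def SignConeOscillatory : Prop :=
  ∀ a : ℝ, 0 < a → ∀ (k : ℕ) (g : Fin k → ℝ → ℂ), (∀ i, (ContDiff ℝ ((⊤ : ℕ∞) : WithTop ℕ∞) (g i) ∧ HasCompactSupport (g i)) ∧ tsupport (g i) ⊆ Set.Icc (-a) a) → let F : ℝ → ℂ := fun t => ∑ i, MeasureTheory.convolution (g i) (fun u => (starRingEnd ℂ) ((g i) (-u))) (ContinuousLinearMap.mul ℂ ℂ) MeasureTheory.MeasureSpace.volume t; (∀ n : ℕ, 2 ≤ n → 0 ≤ (F (Real.log n)).re) → (∃ t : ℝ, Real.log 2 ≤ |t| ∧ (F t).re < 0) → let M : ℂ → ℂ := fun s => ∫ u : ℝ, F u * Complex.exp ((s - 1 / 2) * u); -(F 0).re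 ≤ (M 0 + M 1 + ((1 / (2 * Real.pi) : ℂ) * (∫ t : ℝ, M (1 / 2 + t * Complex.I) * ((Complex.digamma (1 / 4 + t / 2 * Complex.I)).re : ℂ)) - F 0 * (Real.log Real.pi : ℂ))).re

/-- item stmt-RiemannHypothesis-18108 · support · rank 9 · closed · moot by None · by planner
[support] BANKED (rev 7 route-repair: ≡ SignConeInequality ≡ SignConeOscillatory in-tree by the
landed collapse; its only line Sketch ends in stub_offLineMoment ⇒ RH, p158819 =
skeleton.hides-summit; no C′ short of a new mechanism; never to be staffed; landed stubs A/B/D and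
Negative lemmas stay as supports) — the unit-slack sign-cone inequality on the COMPLEMENT class
beyond the certified rung: cutoff a > 13/10 and node-nonnegative F ∈ P(a) whose far-field negativity
is NOT confined to a single window [T, T + log 2] with T ≥ 3 (negativity somewhere in log 2 ≤ |t| <
3, or spread over more than one octave, or both). HONEST LABEL: this child carries the whole
RH-strength content of SignConeOscillatory (crux strategist STRATEGY-CENSUS.md §1.0/§1.D1: every
resonator / anchored-two-bump design tuned to a hypothetical off-line zero is negative already in
(log 2, log 3) — cos(14.13·0.75) = −0.39 —, and coherent multi-window chirp packets fed by one
spectral packet on the large-value set E of ζ are exactly the E-harvest problem of crux idea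
zeta-perron-certificate); RH-implied (p128354) and, with its two siblings, RH-equivalent given
ConeMagnification + SignConeDuality (signConeOscillatory -/
@[route_item "route-RiemannHypothesis-SignCone", crux]
def OscCoherentCore : Prop :=
  ∀ a : ℝ, 0 < a → 13 / 10 < a → ∀ (k : ℕ) (g : Fin k → ℝ → ℂ), (∀ i, (ContDiff ℝ ((⊤ : ℕ∞) : WithTop ℕ∞) (g i) ∧ HasCompactSupport (g i)) ∧ tsupport (g i) ⊆ Set.Icc (-a) a) → let F : ℝ → ℂ := fun t => ∑ i, MeasureTheory.convolution (g i) (fun u => (starRingEnd ℂ) ((g i) (-u))) (ContinuousLinearMap.mul ℂ ℂ) MeasureTheory.MeasureSpace.volume t; (∀ n : ℕ, 2 ≤ n → 0 ≤ (F (Real.log n)).re) → ¬ (∃ T : ℝ, 3 ≤ T ∧ ∀ t : ℝ, Real.log 2 ≤ |t| → (F t).re < 0 → T ≤ |t| ∧ |t| ≤ T + Real.log 2) → (∃ t : ℝ, Real.log 2 ≤ |t| ∧ (F t).re < 0) → let M : ℂ → ℂ := fun s => ∫ u : ℝ, F u * Complex.exp ((s - 1 / 2) * u); -(F 0).re ≤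 (M 0 + M 1 + ((1 / (2 * Real.pi) : ℂ) * (∫ t : ℝ, M (1 / 2 + t * Complex.I) * ((Complex.digamma (1 / 4 + t / 2 * Complex.I)).re : ℂ)) - F 0 * (Real.log Real.pi : ℂ))).re

-- earlier Assembly (stmt-RiemannHypothesis-15465, replaced 2026-08-17T12:50:18Z -> stmt-RiemannHypothesis-18116): proved by Summit.RiemannHypothesis.RiemannHypothesis.Theorems.signConeAssembly_proof @ 19f3f593e3d2 — SignConeOscillatory → ConeMagnification → SignConeDuality → SignConeFarField → Summit.RiemannHypothesis
/-- item stmt-RiemannHypothesis-18116 · assembly · rank 1 · closed · proved by Summit.RiemannHypothesis.RiemannHypothesis.Theorems.signConeAssembly_proof @ df7cf94f0bcc (prover) · by planner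
sources: Bombieri2000Weil, archive:2001/summits/rh/routes/slack-weil-cone-magnification
[assembly] the type of the rev-7 deciding theorem `closes` (bridge form): the prime-free sign-cone
inequality X, magnification on the slack cones (ConeMagnification, CLOSED = 2001 W-MAG
kernel-checked) and conic duality at each cutoff (SignConeDuality, CLOSED) give RH; provable now by
`closes` itself. Supersedes the rev-2 four-binder statement SignConeOscillatory → ConeMagnification
→ SignConeDuality → SignConeFarField → RH (stmt-RiemannHypothesis-15465, proved by
Theorems/SignConeAssembly.lean `signConeAssembly_proof`, rendered BLOCKED since the 12:29Z
drop/re-ask of SignConeOscillatory); tree-health for the prover who closes this: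
Theorems/SignConeAssembly.lean still contains `example : Assembly := closes` against the rev-3
closes and must be rewritten as `theorem signConeAssembly_proof : Assembly := fun hX hC h₃ => closes
hX hC h₃` (keep the old four-binder proof under another name if wanted). -/
@[route_item "route-RiemannHypothesis-SignCone", crux]
def Assembly : Prop :=
  SignConeInequality → ConeMagnification → SignConeDuality → Summit.RiemannHypothesis

/-! D-0027 §2.1 — DECIDING THEOREM (planner-authored via `route open/edit --closes-file`; by planner-rbadge-RiemannHypothesis-SignCone-9cfede98-0 2026-08-17T12:40:58Z) — ARCHIVED: route closed (superseded) 2026-08-17T13:36:03Z; kept so importers keep building: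
its hypotheses are this route's items and its conclusion the sub-problem Statement (glue_lint), and it elaborates with this file. -/

@[closes "route-RiemannHypothesis-SignCone"] theorem closes (hX : SignConeInequality) (hC : ConeMagnification) (h₃ : SignConeDuality) :
    Summit.RiemannHypothesis :=
  -- ConeMagnification (CLOSED 2026-08-17T12:30Z: the 2001 magnification theorem W-MAG, kernel-checked) needs a
  -- unit-slack fake von Mangoldt weight at every cutoff; conic duality h₃ (CLOSED) produces it at each cutoff
  -- from the bridge hypothesis hX = the prime-free sign-cone inequality X (RH-equivalent in-tree).
  hC (fun a ha => h₃ a ha (hX a ha))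

end Summit.RiemannHypothesis.RiemannHypothesis.Theses.SignCone
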